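import Summits.Ventures.LatticeQCDFlow.Scaling.GraphSchemeDistanceProfile
import Summits.Ventures.LatticeQCDFlow.Scaling.GraphSchemeUniversalCeiling
import Summits.Ventures.LatticeQCDFlow.Scaling.HotOnlyLadderMixingLaw

/-!
HONEST FRAMING: exact (Metropolis-corrected) sampling algorithms for lattice gauge theory; figures
of merit are autocorrelation/cost numbers at stated couplings and volumes; no continuum-physics
claim.

# HotOnlyGraphSharpLaw — THE HOT-ONLY EXCHANGE SCHEME ON ANY CONNECTED SWAP LIST (`P = t·ptGraphSwap ν^{⊗} e 1 + (1−t)·coordKernel M 0`: swaps with probability `t`, an exact redraw of the hot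
# replica with probability `1−t`, the cold replicas NEVER updated locally — ARBITRARY cold kernels): **`γ(P) = ρ_G` with `h = 1−t`, `((1−ρ_G)/ρ_G)·log((1−ν(u))Σc/4) ≤ t_mix(1/4) ≤
# ⌈(1/ρ_G)·log(4(1−t)/ρ_G)⌉`, `d(n) ≤ ((1−t)/ρ_G)(1−ρ_G)ⁿ`, `t_mix(1/4) ≤ ⌈U·log(4(1−t)U)⌉` WITH `U = 2(K+1)max{K²m/t, 1/(1−t)}`** (lean-2 GEN-48, ours)

Venture-side (OURS).  Cell `lqcd-flow` (pub-lqcd), unit `pub-lqcd-lean-2-g48`, 2026-09-01.  Chapter AI (the sizes of the Robin ground state), file 18 — parents AI16 `GraphSchemeDistanceProfile`, AI8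
`GraphSchemeUniversalCeiling`, AG13 `HotOnlyLadderMixingLaw` (the hot-only weight facts and the idle replacement).  The chapter's hypotheses "idle cold kernels" and "weights `w` with `w_0 > 0`" are
met by the HOT-ONLY allocation `w = 𝟙_0` WHATEVER the cold kernels are (they never fire): `prodKernel 𝟙_0 M = prodKernel 𝟙_0 M^{idle}` (AG13).  So every result of the chapter holds for the scheme
in which cold replicas move only by swaps and the hot replica is redrawn exactly — the replica-exchange idealisation in which all local mixing is delegated to the hottest level — with
`h = 1−t`: the gap IS the topology's Robin rate, the sharp and the universal ceilings, the profile.  No definitions.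

* `hotOnlyGraph_reduce`, `hotOnlyGraph_spectralGap_eq`, `hotOnlyGraph_two_sided_eps`, `hotOnlyGraph_universal_ceiling`.

Literature grade (cell rule): OWN; nothing cited; no new bib keys.
-/

noncomputable section

open Finset Function Matrix
open Literature.Probability.MarkovChains

namespace Summit.Ventures.LatticeQCDFlow.Scaling

variable {S : Type*} [Fintype S] [DecidableEq S] {K m : ℕ} (e : Fin m → Fin (K + 1) × Fin (K + 1)) {ν : S → ℝ} {M : Fin (K + 1) → S → S → ℝ} {t : ℝ}
  {P : (Fin (K + 1) → S) → (Fin (K + 1) → S) → ℝ}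

/-- The idle replacement of the cold kernels: the hot-only graph scheme does not see them. [ours] -/
theorem hotOnlyGraph_reduce (hP : ∀ x y, P x y = t * ptGraphSwap (fun _ : Fin (K + 1) => ν) e (fun _ => Equiv.refl S) x y
      + (1 - t) * prodKernel (fun k : Fin (K + 1) => if k = 0 then (1 : ℝ) else 0) M x y) :
    ∀ x y, P x y = t * ptGraphSwap (fun _ : Fin (K + 1) => ν) e (fun _ => Equiv.refl S) x y
      + (1 - t) * prodKernel (fun k : Fin (K + 1) => if k = 0 then (1 : ℝ) else 0)
          (fun k : Fin (K + 1) => Fin.cases (M 0) (fun _ : Fin K => fun u v : S => if v = u then (1 : ℝ) else 0) k) x y := by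
  intro x y
  rw [hP, prodKernel_hotOnly_congr (M := M) (M' := fun k : Fin (K + 1) => Fin.cases (M 0) (fun _ : Fin K => fun u v : S => if v = u then (1 : ℝ) else 0) k) rfl]

/-- **THE HOT-ONLY SCHEME'S GAP IS THE TOPOLOGY'S ROBIN RATE WITH `h = 1−t`:** connected list, `m ≥ 1`, distinct endpoints, `0 < t < 1`, one positive law `ν`, exact hot sampler `M_0(·,v) = ν(v)`,
ARBITRARY cold kernels, `|S| ≥ 2`; there are `ρ`, `c > 0` (`Σc² = 1`, the vertex equations with `h = 1−t`, `ρ(K+1) ≤ 1−t`) with **`γ(P) = ρ`**. [ours] -/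
theorem hotOnlyGraph_spectralGap_eq [Nontrivial S] (hm : 1 ≤ m) (he : ∀ r, (e r).1 ≠ (e r).2)
    (hconn : ∀ A : Finset (Fin (K + 1)), A.Nonempty → A ≠ univ → ∃ r : Fin m, ((e r).1 ∈ A ∧ (e r).2 ∉ A) ∨ ((e r).2 ∈ A ∧ (e r).1 ∉ A))
    (hν : ∀ v, 0 < ν v) (hν1 : ∑ v, ν v = 1) (hM0 : ∀ u v, M 0 u v = ν v) (ht0 : 0 < t) (ht1 : t < 1)
    (hP : ∀ x y, P x y = t * ptGraphSwap (fun _ : Fin (K + 1) => ν) e (fun _ => Equiv.refl S) x y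
      + (1 - t) * prodKernel (fun k : Fin (K + 1) => if k = 0 then (1 : ℝ) else 0) M x y) :
    ∃ (ρ : ℝ) (c : Fin (K + 1) → ℝ), 0 < ρ ∧ ρ * ((K : ℝ) + 1) ≤ 1 - t ∧ (∀ k, 0 < c k) ∧ ∑ k : Fin (K + 1), c k ^ 2 = 1 ∧
      (∀ k : Fin (K + 1), t / m * ∑ r : Fin m, ((if k = (e r).1 then c (e r).2 - c (e r).1 else 0) + (if k = (e r).2 then c (e r).1 - c (e r).2 else 0))
        - (if k = 0 then (1 - t) * c k else 0) = -ρ * c k) ∧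
      spectralGap (tensorFun (fun _ : Fin (K + 1) => ν)) P = ρ := by
  obtain ⟨hw0, hw00, hw1⟩ := hotOnlyWeight_facts (K := K)
  have h := graphScheme_spectralGap_exists e (M := fun k : Fin (K + 1) => Fin.cases (M 0) (fun _ : Fin K => fun u v : S => if v = u then (1 : ℝ) else 0) k)
    (w := fun k : Fin (K + 1) => if k = 0 then (1 : ℝ) else 0) hm he hconn hν hν1 (fun u v => by simp only [Fin.cases_zero]; exact hM0 u v)
    (fun i u v => by simp only [Fin.cases_succ]) hw0 hw00 hw1 ht0 ht1 (hotOnlyGraph_reduce e hP)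
  simp only [if_true, mul_one] at h
  exact h

/-- **THE HOT-ONLY SCHEME, EVERY `ε`:** under the same hypotheses there is `ρ = γ(P)` (`ρ(K+1) ≤ 1−t`) with `d(n) ≤ ((1−t)/ρ)(1−ρ)ⁿ` for every `n` and, for every `ε > 0`,
**`(1/ρ − 1)·log(1/(2ε)) ≤ t_mix(ε) ≤ ⌈(1/ρ)·log((1−t)/(ρε))⌉`**. [ours] -/
theorem hotOnlyGraph_two_sided_eps [Nontrivial S] (hm : 1 ≤ m) (he : ∀ r, (e r).1 ≠ (e r).2)
    (hconn : ∀ A : Finset (Fin (K + 1)), A.Nonempty → A ≠ univ → ∃ r : Fin m, ((e r).1 ∈ A ∧ (e r).2 ∉ A) ∨ ((e r).2 ∈ A ∧ (e r).1 ∉ A))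
    (hν : ∀ v, 0 < ν v) (hν1 : ∑ v, ν v = 1) (hM0 : ∀ u v, M 0 u v = ν v) (ht0 : 0 < t) (ht1 : t < 1)
    (hP : ∀ x y, P x y = t * ptGraphSwap (fun _ : Fin (K + 1) => ν) e (fun _ => Equiv.refl S) x y
      + (1 - t) * prodKernel (fun k : Fin (K + 1) => if k = 0 then (1 : ℝ) else 0) M x y) {ε : ℝ} (hε : 0 < ε) :
    ∃ ρ : ℝ, 0 < ρ ∧ ρ * ((K : ℝ) + 1) ≤ 1 - t ∧ spectralGap (tensorFun (fun _ : Fin (K + 1) => ν)) P = ρ ∧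
      (∀ n : ℕ, worstTvDist P (tensorFun (fun _ : Fin (K + 1) => ν)) n ≤ (1 - t) / ρ * (1 - ρ) ^ n) ∧
      (1 / ρ - 1) * Real.log (1 / (2 * ε)) ≤ (mixingTime P (tensorFun (fun _ : Fin (K + 1) => ν)) ε : ℝ) ∧
      mixingTime P (tensorFun (fun _ : Fin (K + 1) => ν)) ε ≤ ⌈1 / ρ * Real.log ((1 - t) / (ρ * ε))⌉₊ := by
  obtain ⟨hw0, hw00, hw1⟩ := hotOnlyWeight_facts (K := K)
  have h := graphScheme_mixingTime_two_sided_eps e (M := fun k : Fin (K + 1) => Fin.cases (M 0) (fun _ : Fin K => fun u v : S => if v = u then (1 : ℝ) else 0) k)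
    (w := fun k : Fin (K + 1) => if k = 0 then (1 : ℝ) else 0) hm he hconn hν hν1 (fun u v => by simp only [Fin.cases_zero]; exact hM0 u v)
    (fun i u v => by simp only [Fin.cases_succ]) hw0 hw00 hw1 ht0 ht1 (hotOnlyGraph_reduce e hP) hε
  simp only [if_true, mul_one] at h
  exact h

/-- **THE HOT-ONLY SCHEME'S UNIVERSAL CEILING:** under the same hypotheses with `K ≥ 1` (no `|S| ≥ 2` needed),
**`t_mix(1/4) ≤ ⌈U·log(4(1−t)U)⌉`, `U = max{2(K+1)K²m/t, 2(K+1)/(1−t)}`**. [ours] -/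
theorem hotOnlyGraph_universal_ceiling (hm : 1 ≤ m) (hK : 1 ≤ K) (he : ∀ r, (e r).1 ≠ (e r).2)
    (hconn : ∀ A : Finset (Fin (K + 1)), A.Nonempty → A ≠ univ → ∃ r : Fin m, ((e r).1 ∈ A ∧ (e r).2 ∉ A) ∨ ((e r).2 ∈ A ∧ (e r).1 ∉ A))
    (hν : ∀ v, 0 < ν v) (hν1 : ∑ v, ν v = 1) (hM0 : ∀ u v, M 0 u v = ν v) (ht0 : 0 < t) (ht1 : t < 1)
    (hP : ∀ x y, P x y = t * ptGraphSwap (fun _ : Fin (K + 1) => ν) e (fun _ => Equiv.refl S) x y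
      + (1 - t) * prodKernel (fun k : Fin (K + 1) => if k = 0 then (1 : ℝ) else 0) M x y) :
    mixingTime P (tensorFun (fun _ : Fin (K + 1) => ν)) (1 / 4)
      ≤ ⌈max (1 / (t / (2 * ((K : ℝ) + 1) * (K : ℝ) ^ 2 * m))) (1 / ((1 - t) / (2 * ((K : ℝ) + 1))))
          * Real.log (4 * (1 - t) * max (1 / (t / (2 * ((K : ℝ) + 1) * (K : ℝ) ^ 2 * m))) (1 / ((1 - t) / (2 * ((K : ℝ) + 1)))))⌉₊ := by
  obtain ⟨hw0, hw00, hw1⟩ := hotOnlyWeight_facts (K := K)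
  have h := graphScheme_universal_ceiling e (M := fun k : Fin (K + 1) => Fin.cases (M 0) (fun _ : Fin K => fun u v : S => if v = u then (1 : ℝ) else 0) k)
    (w := fun k : Fin (K + 1) => if k = 0 then (1 : ℝ) else 0) hm hK he hconn hν hν1 (fun u v => by simp only [Fin.cases_zero]; exact hM0 u v)
    (fun i u v => by simp only [Fin.cases_succ]) hw0 hw00 hw1 ht0 ht1 (hotOnlyGraph_reduce e hP)
  simp only [if_true, mul_one] at h
  exact h

end Summit.Ventures.LatticeQCDFlow.Scaling

end
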